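import Summits.KontsevichZagierPeriods.KontsevichZagierPeriods.Theses.HurwitzMicroSectors
import Summits.KontsevichZagierPeriods.KontsevichZagierPeriods.Theorems.HurwitzMicroSectorsNormalFormPrinciplePiBoxTransfer

/-! TTRL-lite variant V2319 of stmt-KontsevichZagierPeriods-3869

Variant V2319 = `stub_boxRigidity` (the leaf `BoxRigidity` of `NormalFormPrinciple`: two representations
on open unit boxes with integrands of KZ's rational shape `p/q` over `ℚ` and equal values are
KZ-equivalent) under the TWO-sided move `fix_nat:m=8; fix_nat:m'=2` (left dimension frozen to `8`, right
dimension to `2`). Verdict of the attempt seat: **open** — this file is the exact-strength certificate,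
not a proof of the variant. For every `K` let `BoxVanishing K` say that a box-rational representation of
dimension `K` and value `0` is a relation. The frozen pair `(8, 2)` is exactly `BoxVanishing 8`
(proved here self-containedly from the tree's `pad_le` / `sub_same` / `exists_zeroRep` and soundness
`relations_le_ker_eval_holds`): compare a vanishing box-rational representation on `(0,1)⁸` with the
zero representation on the square one way (`boxVanishing_eight_of_stub_boxRigidity_var2319`); pad both
representations to `(0,1)⁸` (Newton–Leibniz moves plus null faces) and subtract there (rule 1b)) the
other way (`boxRigidityLe_eight_of_boxVanishing_eight`). Hence
`V2319 ⟺ BoxVanishing 8 ⟺ BoxRigidity for all m, m' ≤ 8`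
(`stub_boxRigidity_var2319_iff_boxVanishing_eight`, `stub_boxRigidity_var2319_iff_le_eight`); V2319 gives
`BoxVanishing j` for every `j ≤ 8` (`boxVanishing_le_eight_of_stub_boxRigidity_var2319`) and therefore
every two-sided sibling of maximal dimension `≤ 8` (`boxRigidityFix_of_stub_boxRigidity_var2319`; e.g.
V2227 = the pair `(2, 6)` and V2228 = `m = 2, m' ≤ 6`). `BoxVanishing 1` is a theorem of the tree
(`boxRigidity_of_le_one`, Baker); from dimension `2` on it is open: `BoxVanishing 5` (a consequence of
V2319) contains "for `a b : ℚ`, `a + b·ζ(5) = 0 ⇒ [a + b/(1 − x₁⋯x₅)]_{(0,1)⁵}` is a relation", provable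
today only through the irrationality of `ζ(5)` (open) or an explicit chain of moves (none can exist
unless `ζ(5) ∈ ℚ`); `BoxVanishing 2` contains the same dichotomy for Catalan's `G = ∫∫ dx dy/(1+x²y²)`.
Conversely `KontsevichZagierPeriods → parent → V2319` (`stub_boxRigidity_var2319_of_statement`), so a
refutation of the variant would refute the Summit (Conjecture 1 for the tree's calculus); no invariant of
`KZ.relations` finer than `KZ.eval` is known. Source: M. Kontsevich, D. Zagier, *Periods* (2001), §1.2
Conjecture 1 and rules 1)–3). Pure proof file, no definitions. -/

-- `Summit.<Summit>.<Problem>` is the tree's mandated summit-side namespace (CONVENTIONS §2); for this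
-- single-conjunct summit the two coincide, so the duplicate is deliberate.
set_option linter.dupNamespace false

noncomputable section

namespace Summit.KontsevichZagierPeriods.KontsevichZagierPeriods.Theorems

open MeasureTheory Set
open Literature.NumberTheory.Transcendental Literature.NumberTheory.Transcendental.KZ
open Summit.KontsevichZagierPeriods.KontsevichZagierPeriods.Theses.HurwitzMicroSectors
open Summit.KontsevichZagierPeriods.HurwitzMicroSectors.NormalFormPrinciple.PiBox
open Summit.KontsevichZagierPeriods.HurwitzMicroSectors.NormalFormPrinciple.PiBox.stub_boxCombineAux
  (pad_le sub_same)

/-! ## The two halves: V2319 ⇒ `BoxVanishing 8` ⇒ `BoxRigidity` for `m, m' ≤ 8` -/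

/-- **V2319 ⇒ `BoxVanishing 8`**: a box-rational representation on `(0,1)⁸` of value `0` is, by the
variant, KZ-equivalent to the zero representation on the square (box-rational, value `0`), which is
itself a relation (rule 1b)). [cite: KontsevichZagier2001, §1.2 Conjecture 1] -/
theorem boxVanishing_eight_of_stub_boxRigidity_var2319
    (h : ∀ (N : IntegralRep 8) (N' : IntegralRep 2), N.domain = {x | ∀ i, x i ∈ Set.Ioo (0:ℝ) 1} → N.IsRational → N'.domain = {x | ∀ i, x i ∈ Set.Ioo (0:ℝ) 1} → N'.IsRational → N.value = N'.value → Equivalent N N')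
    (M : IntegralRep 8) (hMd : M.domain = {x | ∀ i, x i ∈ Set.Ioo (0:ℝ) 1}) (hMr : M.IsRational)
    (hv : M.value = 0) : of M ∈ relations := by
  obtain ⟨Z, hZd, hZi⟩ := exists_zeroRep (isSemialgebraic_box 2)
  have hZ : of Z ∈ relations := of_mem_relations_of_eqOn_zero Z (by simp [hZi, EqOn])
  have hZv : Z.value = 0 := by simp [IntegralRep.value, hZi]
  have hZr : Z.IsRational := ⟨0, 1, fun x _ => by simp, fun x _ => by simp [hZi]⟩
  have hMZ : of M - of Z ∈ relations := h M Z hMd hMr hZd hZr (by rw [hv, hZv])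
  simpa using relations.add_mem hMZ hZ

/-- **`BoxVanishing 8` ⇒ rigidity for all dimensions `m, m' ≤ 8`**: pad both representations to
`(0,1)⁸` (`pad_le`), subtract the integrands there (`sub_same`, rule 1b)); the difference is
box-rational of value `0` by soundness, hence a relation. [cite: KontsevichZagier2001, §1.2 Conjecture 1] -/
theorem boxRigidityLe_eight_of_boxVanishing_eight
    (hvan : ∀ (M : IntegralRep 8), M.domain = {x | ∀ i, x i ∈ Set.Ioo (0:ℝ) 1} → M.IsRational →
      M.value = 0 → of M ∈ relations) :
    ∀ (m m' : ℕ) (N : IntegralRep m) (N' : IntegralRep m'), m ≤ 8 → m' ≤ 8 →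
      N.domain = {x | ∀ i, x i ∈ Set.Ioo (0:ℝ) 1} → N.IsRational →
      N'.domain = {x | ∀ i, x i ∈ Set.Ioo (0:ℝ) 1} → N'.IsRational →
      N.value = N'.value → Equivalent N N' := by
  intro m m' N N' hm hm' hNd hNr hN'd hN'r hv
  obtain ⟨R₁, h₁d, h₁r, h₁⟩ := pad_le hm N hNd hNr
  obtain ⟨R₂, h₂d, h₂r, h₂⟩ := pad_le hm' N' hN'd hN'r
  obtain ⟨M, hMd, hMr, hM⟩ := sub_same R₁ R₂ h₁d h₁r h₂d h₂r
  have hMv : M.value = 0 := by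
    have e₁ := relations_le_ker_eval_holds h₁
    have e₂ := relations_le_ker_eval_holds h₂
    have e := relations_le_ker_eval_holds hM
    simp only [AddMonoidHom.mem_ker, map_sub, eval_of] at e₁ e₂ e
    linarith
  have e : of N - of N' = (of N - of R₁) - (of N' - of R₂) + (of R₁ - of R₂ - of M) + of M := by
    abel
  show of N - of N' ∈ relations
  rw [e]
  exact relations.add_mem (relations.add_mem (relations.sub_mem h₁ h₂) hM) (hvan M hMd hMr hMv)

/-! ## The variant V2319 itself: exactly `BoxVanishing 8` -/

/-- **V2319 ⟺ `BoxVanishing 8`** (the pair `(8, 2)` is allowed, `2 ≤ 8`).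
[cite: KontsevichZagier2001, §1.2 Conjecture 1] -/
theorem stub_boxRigidity_var2319_iff_boxVanishing_eight :
    (∀ (N : IntegralRep 8) (N' : IntegralRep 2), N.domain = {x | ∀ i, x i ∈ Set.Ioo (0:ℝ) 1} → N.IsRational → N'.domain = {x | ∀ i, x i ∈ Set.Ioo (0:ℝ) 1} → N'.IsRational → N.value = N'.value → Equivalent N N') ↔
    (∀ (M : IntegralRep 8), M.domain = {x | ∀ i, x i ∈ Set.Ioo (0:ℝ) 1} → M.IsRational →
      M.value = 0 → of M ∈ relations) :=
  ⟨boxVanishing_eight_of_stub_boxRigidity_var2319,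
    fun hvan N N' => boxRigidityLe_eight_of_boxVanishing_eight hvan 8 2 N N' le_rfl (by norm_num)⟩

/-- **V2319 ⟺ `BoxRigidity` for all `m, m' ≤ 8`** (so V2319 coincides with the two-sided variants
`bound_nat:m≤8; bound_nat:m'≤8` and `fix_nat:m=j; fix_nat:m'=k` for every `max j k = 8`): freezing the
right dimension to `2` rather than `8` loses nothing, by padding. [cite: KontsevichZagier2001, §1.2 Conjecture 1] -/
theorem stub_boxRigidity_var2319_iff_le_eight :
    (∀ (N : IntegralRep 8) (N' : IntegralRep 2), N.domain = {x | ∀ i, x i ∈ Set.Ioo (0:ℝ) 1} → N.IsRational → N'.domain = {x | ∀ i, x i ∈ Set.Ioo (0:ℝ) 1} → N'.IsRational → N.value = N'.value → Equivalent N N') ↔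
    (∀ (m m' : ℕ) (N : IntegralRep m) (N' : IntegralRep m'), m ≤ 8 → m' ≤ 8 →
      N.domain = {x | ∀ i, x i ∈ Set.Ioo (0:ℝ) 1} → N.IsRational →
      N'.domain = {x | ∀ i, x i ∈ Set.Ioo (0:ℝ) 1} → N'.IsRational →
      N.value = N'.value → Equivalent N N') :=
  ⟨fun h => boxRigidityLe_eight_of_boxVanishing_eight (boxVanishing_eight_of_stub_boxRigidity_var2319 h),
    fun h N N' => h 8 2 N N' le_rfl (by norm_num)⟩

/-- **V2319 is the same statement as the swapped pair `(2, 8)`** (symmetry of `Equivalent`: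
relations form a subgroup). [cite: KontsevichZagier2001, §1.2 Conjecture 1] -/
theorem stub_boxRigidity_var2319_iff_swap :
    (∀ (N : IntegralRep 8) (N' : IntegralRep 2), N.domain = {x | ∀ i, x i ∈ Set.Ioo (0:ℝ) 1} → N.IsRational → N'.domain = {x | ∀ i, x i ∈ Set.Ioo (0:ℝ) 1} → N'.IsRational → N.value = N'.value → Equivalent N N') ↔
    (∀ (N : IntegralRep 2) (N' : IntegralRep 8), N.domain = {x | ∀ i, x i ∈ Set.Ioo (0:ℝ) 1} →
      N.IsRational → N'.domain = {x | ∀ i, x i ∈ Set.Ioo (0:ℝ) 1} → N'.IsRational →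
      N.value = N'.value → Equivalent N N') := by
  constructor <;> intro h N N' hNd hNr hN'd hN'r hv <;>
    simpa [Equivalent] using relations.neg_mem (h N' N hN'd hN'r hNd hNr hv.symm)

/-! ## Consequences: all lower dimensions, all two-sided siblings of maximal dimension `≤ 8` -/

/-- **V2319 ⇒ `BoxVanishing` in every dimension `j ≤ 8`** (pad to `(0,1)⁸`; the value is unchanged by
soundness): in particular the dimension-`5` statement containing the `ζ(5)` dichotomy, the
dimension-`3` one (`ζ(3)`, `π³`, `Li₃` values) and the dimension-`2` one containing Catalan's.
[cite: KontsevichZagier2001, §1.2 Conjecture 1] -/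
theorem boxVanishing_le_eight_of_stub_boxRigidity_var2319
    (h : ∀ (N : IntegralRep 8) (N' : IntegralRep 2), N.domain = {x | ∀ i, x i ∈ Set.Ioo (0:ℝ) 1} → N.IsRational → N'.domain = {x | ∀ i, x i ∈ Set.Ioo (0:ℝ) 1} → N'.IsRational → N.value = N'.value → Equivalent N N')
    {j : ℕ} (hj : j ≤ 8) (N : IntegralRep j) (hNd : N.domain = {x | ∀ i, x i ∈ Set.Ioo (0:ℝ) 1})
    (hNr : N.IsRational) (hv : N.value = 0) : of N ∈ relations := by
  obtain ⟨R, hRd, hRr, hR⟩ := pad_le hj N hNd hNr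
  have hRv : R.value = 0 := by
    have e := relations_le_ker_eval_holds hR
    simp only [AddMonoidHom.mem_ker, map_sub, eval_of] at e
    linarith
  have := relations.add_mem hR (boxVanishing_eight_of_stub_boxRigidity_var2319 h R hRd hRr hRv)
  rwa [sub_add_cancel] at this

/-- **V2319 ⇒ every frozen pair `(j, k)` with `j, k ≤ 8`** (all two-sided siblings of maximal dimension
at most `8` at once). [cite: KontsevichZagier2001, §1.2 Conjecture 1] -/
theorem boxRigidityFix_of_stub_boxRigidity_var2319
    (h : ∀ (N : IntegralRep 8) (N' : IntegralRep 2), N.domain = {x | ∀ i, x i ∈ Set.Ioo (0:ℝ) 1} → N.IsRational → N'.domain = {x | ∀ i, x i ∈ Set.Ioo (0:ℝ) 1} → N'.IsRational → N.value = N'.value → Equivalent N N')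
    {j k : ℕ} (hj : j ≤ 8) (hk : k ≤ 8) :
    ∀ (N : IntegralRep j) (N' : IntegralRep k), N.domain = {x | ∀ i, x i ∈ Set.Ioo (0:ℝ) 1} →
      N.IsRational → N'.domain = {x | ∀ i, x i ∈ Set.Ioo (0:ℝ) 1} → N'.IsRational →
      N.value = N'.value → Equivalent N N' :=
  fun N N' => stub_boxRigidity_var2319_iff_le_eight.1 h j k N N' hj hk

/-- **V2319 ⇒ the sibling V2227** (`fix_nat:m=2; fix_nat:m'=6`, which is `BoxVanishing 6`): the
two-sided variants are linearly ordered by their largest dimension. [cite: KontsevichZagier2001, §1.2 Conjecture 1] -/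
theorem stub_boxRigidity_var2227_of_var2319
    (h : ∀ (N : IntegralRep 8) (N' : IntegralRep 2), N.domain = {x | ∀ i, x i ∈ Set.Ioo (0:ℝ) 1} → N.IsRational → N'.domain = {x | ∀ i, x i ∈ Set.Ioo (0:ℝ) 1} → N'.IsRational → N.value = N'.value → Equivalent N N') :
    ∀ (N : IntegralRep 2) (N' : IntegralRep 6), N.domain = {x | ∀ i, x i ∈ Set.Ioo (0:ℝ) 1} → N.IsRational → N'.domain = {x | ∀ i, x i ∈ Set.Ioo (0:ℝ) 1} → N'.IsRational → N.value = N'.value → Equivalent N N' :=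
  boxRigidityFix_of_stub_boxRigidity_var2319 h (by norm_num) (by norm_num)

/-- **V2319 ⇒ the sibling V2228** (`fix_nat:m=2; bound_nat:m'≤6`, also `BoxVanishing 6`).
[cite: KontsevichZagier2001, §1.2 Conjecture 1] -/
theorem stub_boxRigidity_var2228_of_var2319
    (h : ∀ (N : IntegralRep 8) (N' : IntegralRep 2), N.domain = {x | ∀ i, x i ∈ Set.Ioo (0:ℝ) 1} → N.IsRational → N'.domain = {x | ∀ i, x i ∈ Set.Ioo (0:ℝ) 1} → N'.IsRational → N.value = N'.value → Equivalent N N') :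
    ∀ (m' : ℕ) (N : IntegralRep 2) (N' : IntegralRep m'), m' ≤ 6 → N.domain = {x | ∀ i, x i ∈ Set.Ioo (0:ℝ) 1} → N.IsRational → N'.domain = {x | ∀ i, x i ∈ Set.Ioo (0:ℝ) 1} → N'.IsRational → N.value = N'.value → Equivalent N N' :=
  fun _ N N' hm' => boxRigidityFix_of_stub_boxRigidity_var2319 h (by norm_num) (hm'.trans (by norm_num)) N N'

/-! ## From above: the residual, the parent leaf, the Summit -/

/-- **`BoxVanishing 8` alone already proves V2319** (the honest residual of the variant: whoever settles
Conjecture 1 for vanishing box-rational periods of dimension `8` settles V2319, and conversely).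
[cite: KontsevichZagier2001, §1.2 Conjecture 1] -/
theorem stub_boxRigidity_var2319_of_boxVanishing_eight
    (hvan : ∀ (M : IntegralRep 8), M.domain = {x | ∀ i, x i ∈ Set.Ioo (0:ℝ) 1} → M.IsRational →
      M.value = 0 → of M ∈ relations) :
    ∀ (N : IntegralRep 8) (N' : IntegralRep 2), N.domain = {x | ∀ i, x i ∈ Set.Ioo (0:ℝ) 1} → N.IsRational → N'.domain = {x | ∀ i, x i ∈ Set.Ioo (0:ℝ) 1} → N'.IsRational → N.value = N'.value → Equivalent N N' :=
  stub_boxRigidity_var2319_iff_boxVanishing_eight.2 hvan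

/-- **The parent leaf ⇒ V2319** (specialisation `m := 8`, `m' := 2`; the converse is not claimed — the
parent is `BoxVanishing` in ALL dimensions). [cite: KontsevichZagier2001, §1.2 Conjecture 1] -/
theorem stub_boxRigidity_var2319_of_parent
    (h : ∀ (m m' : ℕ) (N : IntegralRep m) (N' : IntegralRep m'), N.domain = {x | ∀ i, x i ∈ Set.Ioo (0:ℝ) 1} → N.IsRational → N'.domain = {x | ∀ i, x i ∈ Set.Ioo (0:ℝ) 1} → N'.IsRational → N.value = N'.value → Equivalent N N') :
    ∀ (N : IntegralRep 8) (N' : IntegralRep 2), N.domain = {x | ∀ i, x i ∈ Set.Ioo (0:ℝ) 1} → N.IsRational → N'.domain = {x | ∀ i, x i ∈ Set.Ioo (0:ℝ) 1} → N'.IsRational → N.value = N'.value → Equivalent N N' :=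
  h 8 2

/-- **`KontsevichZagierPeriods ⇒ V2319`**: the variant is a special case of Conjecture 1 for the tree's
calculus (`leaves_of_statement`) — so a refutation of the variant would refute the Summit.
[cite: KontsevichZagier2001, §1.2 Conjecture 1] -/
theorem stub_boxRigidity_var2319_of_statement (h : _root_.KontsevichZagierPeriods) :
    ∀ (N : IntegralRep 8) (N' : IntegralRep 2), N.domain = {x | ∀ i, x i ∈ Set.Ioo (0:ℝ) 1} → N.IsRational → N'.domain = {x | ∀ i, x i ∈ Set.Ioo (0:ℝ) 1} → N'.IsRational → N.value = N'.value → Equivalent N N' :=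
  stub_boxRigidity_var2319_of_parent (leaves_of_statement h).1

end Summit.KontsevichZagierPeriods.KontsevichZagierPeriods.Theorems

end
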